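import Summits.QuantumFields.BalabanUV.T4Continuum.Support.BalabanHardMinimizer

/-!
# T⁴ programme, spine node NE2 (U1a) — the `U = 1` INVERSE LAYER for Bałaban's averaging, ASSEMBLED:
# coercivity, the η-rate of `(n^d Q_k𝒢Q_kᴴ)⁻¹`, the hard minimiser `GQ*(QGQ*)⁻¹`, and the η-rate of `Δ_K = (QGQ*)⁻¹-type − a`

Eighth generation of the NE2 prover lineage P1 of the cell `pub-balaban`, file 15 — the companion of `Spine/NE2UnitLayer` (file 11,
the SANDWICHED side: covariances `c_k = n^d Q_k𝒢Q_kᴴ`, soft minimisers, soft effective operators `a − a²c_k`) for the INVERSE /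
δ-FUNCTION side of node U1a's unit-lattice objects (T4-DAG X8 `Δ_k`, X10 `H_k`, X11 `(QGQ*)^{−1}`), at `U = 1`, on a fixed finite
torus, along the levels `n_k = L^k`:

* `UnitInverseLayer L M a ha` (a `Prop` structure; every field is PROVED in files 10, 12–14, none is a hypothesis):
  (1) `coercive` — the typed input `UniformCoercive L M a γ(d,a)` of `Spine/CoerciveInverseTower` HOLDS,
      `γ(d,a) = ((dπ² + a)(π²/4)^{d+1})⁻¹` (file 13 `uniformCoercive_unitCovB`, from file 12's one-level coercivity);
  (2) `invTower` — `c_k → c_∞`, `c_∞` is `γ`-coercive, `c_k⁻¹ → c_∞⁻¹`, `‖c_k⁻¹ − c_∞⁻¹‖ ≤ γ⁻²·CQB·L^{−k}/(1 − L^{−1})` on the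
      tower's carrier (file 13 `inv_unitCovB_tendsto`); (3) `invTowerB` — the same read on the leaf's fixed carrier `Tor M × Fin d`
      for `covBlev k = covB (L^k)` (file 13 `covBlev_tendsto`);
  (4) `dictionary` — at every level, for every fine `A` with `Q_kA = B`: `⟨A, Δ₀A⟩ = n_k^d⟨B, Δ_K^{(k)}B⟩ + ⟨A − H B, Δ_a(A − H B)⟩`,
      `Δ₀ = Δ_a − aQ*Q` = «Δ − ∂P∂*» (1.69), `Δ_K^{(k)} = (covB (L^k))⁻¹ − a`, `H = 𝒢Q_kᴴ(n^d covB⁻¹)` = «GQ*(QGQ*)^{−1}» (file 14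
      `form_Delta0_eq`); (5) `minimizer` — «Q_kH_kB = B» and the minimum `η^d min_{Q_kA=B}⟨A, Δ₀A⟩ = ⟨B, Δ_K B⟩` is ATTAINED at
      `H B` (file 14 `QvOp_mulVec_Hk`, `form_Delta0_Hk`); (6) `deltaKTower` — `Δ_K^{(k)}` converges,
      `‖Δ_K^{(k)} − Δ_K^{(∞)}‖ ≤ γ⁻²·CQB·L^{−k}/(1 − L^{−1})` (file 14 `DeltaKlev_tendsto`).
* `ne2UnitInverseLayer (hL : 2 ≤ L) : UnitInverseLayer L M a ha` — it HOLDS, for every torus `M`, every `a > 0`, every `d`.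
* `inversePlus_of_coercive_tower` — the `U ≠ 1` WALL BY NAME for this side: for ANY tower of matrices (the background objects
  `Q_k(U)G_k(U)Q_k(U)^*` once they exist in the tree), uniform coercivity + a geometric rate give the rate of the inverses
  (`CoerciveInverseTower.inverse_tower_of_coercive`, restated; nothing discharged at `U ≠ 1`).

WHAT IS LEFT AT `U = 1` (one printed identity): `Δ_K = Δ_k` of [Balaban1984PropagatorsI] (1.65) «⟨B, Δ_kB⟩ = ⟨∂H_kB, ∂H_kB⟩»
needs (1.95)/(2.34) «R∂*GQ* = 0» for the CONCRETE lattice operators (then the `∂R∂*` part of `Δ₀` vanishes at `H B`); the tree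
certifies it only over abstract operator data (`B5HkProperties`).  Constants at `d = 4` are explicit but the chain `CQB = CQ +
2d·Cst` is not evaluated numerically.

HONEST FRAMING (T4-DAG p. 1).  Assembly of PROVED `U = 1` statements about the cell's own finite-torus objects; [folklore] linear
algebra, constants OURS; NOT `U ≠ 1` (WALL G-an2-4: the background carriers are not in the tree), NOT infinite volume, NOT a mass
gap, NOT Clay, NOT summit progress; spine estimates proved: 0/9.  HONEST DEPENDENCY: continuum YM on T⁴ ⇐ BetaPertH ∧ nine spine
estimates (0/9 proved); BetaPertH ⇐ (D1) ∧ (D4) ∧ CAP+tail; G-an2-4 gates asym, D1 and NE2/3/4.  ABSOLUTE RULE kept; no `sorry`.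
-/

noncomputable section

open scoped BigOperators ComplexConjugate Matrix Matrix.Norms.L2Operator Topology
open Filter

namespace Summit.QuantumFields.BalabanUV.T4Continuum.NE2UnitInverseLayer

open Literature.MathematicalPhysics.QuantumFieldTheory.Balaban1983to89.B5Prop11Plancherel
open Literature.MathematicalPhysics.QuantumFieldTheory.Balaban1983to89.B5Prop11Inverse (calDa)
open Literature.MathematicalPhysics.QuantumFieldTheory.Balaban1983to89.B5Block118 (QvOp)
open Literature.MathematicalPhysics.QuantumFieldTheory.Balaban1983to89.B5G183RateUnitTower (lev lev_neZero)
open Summit.QuantumFields.BalabanUV.T4Continuum.CovariantAveragingTower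
open Summit.QuantumFields.BalabanUV.T4Continuum.BalabanLineAverage (CQB)
open Summit.QuantumFields.BalabanUV.T4Continuum.BalabanAveragedTowerUnit
open Summit.QuantumFields.BalabanUV.T4Continuum.CoerciveInverseTower
open Summit.QuantumFields.BalabanUV.T4Continuum.BalabanAveragedCoercive (gammaB gammaB_pos)
open Summit.QuantumFields.BalabanUV.T4Continuum.BalabanAveragedCoerciveTower
open Summit.QuantumFields.BalabanUV.T4Continuum.BalabanHardMinimizer

variable {d : ℕ} (L : ℕ) [NeZero L] (M : Fin d → ℕ) [hM : ∀ μ, NeZero (M μ)] (a : ℝ) (ha : 0 < a)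

/-- **THE `U = 1` INVERSE LAYER OF NE2 FOR BAŁABAN's AVERAGING** as one structure (fields documented in the module docstring;
every field is a statement proved in files 10, 12–14 of the generation, none is a hypothesis). [folklore] -/
structure UnitInverseLayer : Prop where
  /-- (1) uniform coercivity of the averaged covariances along the tower, `γ(d,a) = ((dπ² + a)(π²/4)^{d+1})⁻¹`. -/
  coercive : UniformCoercive L M a ha (gammaB d a)
  /-- (2) the inverse tower on the tower's carrier: limit, coercive limit, convergence of inverses, rate `γ⁻²·CQB·L^{−k}/(1−L^{−1})`. -/
  invTower : ∃ cinf : Matrix (idx L M 0) (idx L M 0) ℂ,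
    Tendsto (unitCovB L M a ha) atTop (𝓝 cinf) ∧ Coercive (gammaB d a) cinf ∧
    Tendsto (fun k => (unitCovB L M a ha k)⁻¹) atTop (𝓝 cinf⁻¹) ∧
    ∀ k, ‖(unitCovB L M a ha k)⁻¹ - cinf⁻¹‖ ≤ ((gammaB d a)⁻¹) ^ 2 * (CQB d a * ((L : ℝ)⁻¹) ^ k / (1 - (L : ℝ)⁻¹))
  /-- (3) the same tower read on the leaf's fixed carrier `Tor M × Fin d` (`covBlev k = covB (L^k)`). -/
  invTowerB : ∃ cinf : Matrix (Tor M × Fin d) (Tor M × Fin d) ℂ,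
    Tendsto (covBlev L M a ha) atTop (𝓝 cinf) ∧
    (∀ k, ‖covBlev L M a ha k - cinf‖ ≤ CQB d a * ((L : ℝ)⁻¹) ^ k / (1 - (L : ℝ)⁻¹)) ∧
    Coercive (gammaB d a) cinf ∧ Tendsto (fun k => (covBlev L M a ha k)⁻¹) atTop (𝓝 cinf⁻¹) ∧
    ∀ k, ‖(covBlev L M a ha k)⁻¹ - cinf⁻¹‖ ≤ ((gammaB d a)⁻¹) ^ 2 * (CQB d a * ((L : ℝ)⁻¹) ^ k / (1 - (L : ℝ)⁻¹))
  /-- (4) the dictionary at every level: for `Q_kA = B`, `⟨A, Δ₀A⟩ = n_k^d⟨B, Δ_K^{(k)}B⟩ + ⟨A − HB, Δ_a(A − HB)⟩`. -/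
  dictionary : ∀ (k : ℕ) (A : Tor (fine (lev L k) M) × Fin d → ℂ) (B : Tor M × Fin d → ℂ),
    QvOp (lev L k) M *ᵥ A = B →
      star A ⬝ᵥ (Delta0 (lev L k) (one_le_lev' L k) M a ha *ᵥ A)
        = (((lev L k : ℕ) : ℂ) ^ d) * (star B ⬝ᵥ (DeltaKlev L M a ha k *ᵥ B))
          + star (A - Hk (lev L k) (one_le_lev' L k) M a ha B)
              ⬝ᵥ (calDa (lev L k) (one_le_lev' L k) M a ha *ᵥ (A - Hk (lev L k) (one_le_lev' L k) M a ha B))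
  /-- (5) the hard minimiser `H = 𝒢Q_kᴴ(n^d covB⁻¹)` hits the constraint and attains the minimum. -/
  minimizer : ∀ (k : ℕ) (B : Tor M × Fin d → ℂ),
    QvOp (lev L k) M *ᵥ Hk (lev L k) (one_le_lev' L k) M a ha B = B ∧
      star (Hk (lev L k) (one_le_lev' L k) M a ha B)
          ⬝ᵥ (Delta0 (lev L k) (one_le_lev' L k) M a ha *ᵥ Hk (lev L k) (one_le_lev' L k) M a ha B)
        = (((lev L k : ℕ) : ℂ) ^ d) * (star B ⬝ᵥ (DeltaKlev L M a ha k *ᵥ B))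
  /-- (6) the hard effective operators `Δ_K^{(k)} = (covB (L^k))⁻¹ − a` converge, rate `γ⁻²·CQB·L^{−k}/(1 − L^{−1})`. -/
  deltaKTower : ∃ Dinf : Matrix (Tor M × Fin d) (Tor M × Fin d) ℂ,
    Tendsto (DeltaKlev L M a ha) atTop (𝓝 Dinf) ∧
    ∀ k, ‖DeltaKlev L M a ha k - Dinf‖ ≤ ((gammaB d a)⁻¹) ^ 2 * (CQB d a * ((L : ℝ)⁻¹) ^ k / (1 - (L : ℝ)⁻¹))

/-- **`ne2UnitInverseLayer`**: the `U = 1` inverse layer of NE2 for Bałaban's averaging HOLDS (`L ≥ 2`, `a > 0`; every torus `M`,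
every `d`). [cite: Balaban1984PropagatorsI, (1.18) p.20, (1.69) p.29, (1.71) p.30; Balaban1984PropagatorsII, (2.35) p.228 (objects);
statements ours] [folklore] -/
theorem ne2UnitInverseLayer (hL : 2 ≤ L) : UnitInverseLayer L M a ha :=
  ⟨uniformCoercive_unitCovB L M a ha, inv_unitCovB_tendsto L M a ha hL, covBlev_tendsto L M a ha hL,
    fun k A B h => form_Delta0_eq (lev L k) (one_le_lev' L k) M a ha A B h,
    fun k B => ⟨QvOp_mulVec_Hk (lev L k) (one_le_lev' L k) M a ha B, form_Delta0_Hk (lev L k) (one_le_lev' L k) M a ha B⟩,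
    DeltaKlev_tendsto L M a ha hL⟩

/-- the minimum principle spelled out: at every level, `n_k^d·Re⟨B, Δ_K^{(k)}B⟩ ≤ Re⟨A, Δ₀A⟩` for every `A` with `Q_kA = B`, with
equality at `A = HB`. [folklore] -/
theorem re_form_DeltaKlev_le (k : ℕ) (A : Tor (fine (lev L k) M) × Fin d → ℂ) (B : Tor M × Fin d → ℂ)
    (hA : QvOp (lev L k) M *ᵥ A = B) :
    (L : ℝ) ^ (d * k) * (star B ⬝ᵥ (DeltaKlev L M a ha k *ᵥ B)).re
      ≤ (star A ⬝ᵥ (Delta0 (lev L k) (one_le_lev' L k) M a ha *ᵥ A)).re := by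
  have h := re_form_DeltaK_le (lev L k) (one_le_lev' L k) M a ha A B hA
  have e : ((lev L k : ℕ) : ℝ) ^ d = (L : ℝ) ^ (d * k) := by rw [cast_lev', ← pow_mul, mul_comm]
  rw [e] at h
  exact h

/-- the `U ≠ 1` WALL, by name, for the inverse side: GIVEN a tower of `γ`-coercive matrices converging at a geometric rate
(what NE2 proper needs for `Q_k(U)G_k(U)Q_k(U)^*`, not in the tree), the inverses converge at `γ⁻²×` that rate.  A restatement of
`CoerciveInverseTower.inverse_tower_of_coercive` for the record; nothing at `U ≠ 1` is discharged. [folklore] -/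
theorem inversePlus_of_coercive_tower {ι : Type*} [Fintype ι] [DecidableEq ι] {γ : ℝ} (hγ : 0 < γ)
    {c : ℕ → Matrix ι ι ℂ} (wall : ∀ k, Coercive γ (c k)) {cinf : Matrix ι ι ℂ} (hlim : Tendsto c atTop (𝓝 cinf))
    {C ρ : ℝ} (hρ0 : 0 ≤ ρ) (hρ1 : ρ < 1) (hrate : ∀ k, ‖c k - cinf‖ ≤ C * ρ ^ k / (1 - ρ)) :
    Coercive γ cinf ∧ Tendsto (fun k => (c k)⁻¹) atTop (𝓝 cinf⁻¹) ∧
      ∀ k, ‖(c k)⁻¹ - cinf⁻¹‖ ≤ (γ⁻¹) ^ 2 * (C * ρ ^ k / (1 - ρ)) :=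
  inverse_tower_of_coercive hγ wall hlim hρ0 hρ1 hrate

end Summit.QuantumFields.BalabanUV.T4Continuum.NE2UnitInverseLayer

end
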